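import Mathlib
import Summits.Ventures.PercRepro2.HCov
import Summits.Ventures.PercRepro2.RootPairSep
import Summits.Ventures.PercRepro2.PMPendantLeaf
import Summits.Ventures.PercRepro2.PMPendantMasses
import Summits.Ventures.PercRepro2.PMPendantDict

/-!
# The middle coefficient IS the weighted (PM) bracket: `twoBeta1 = 2 β₁`
(blind cell PercRepro2, mine-2 g22; row 2′BETA1; proofs/MINE2-CUTU.md §13, the dictionary of M2-35)

With `a₃` isolated (`p₀ = p[f ↦ 0]`), the middle Bernstein coefficient `twoBeta1` of the covariance form
in the pendant weight (`PMPendantDict.Gc_pendant_quadratic`) equals twice the typed bracket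
`β₁ = (HALF-PM⁺)_L + (HALF-PM⁺)_H + A` of `RootPairSepTyped.lean` (the expression of
`beta1_eq_zero_of_b_alone`, marks `(a₁, a₂, o, u, b)`) at `p₀` — a FORMAL polynomial identity in the masses
`P(Q ∩ …)` once the unions `{x ∈ C₁ ∪ C₂}` are split (disjoint on `Q`: `prob_union_Q`) and the complements
`{u ∉ C₁ ∪ C₂}` are expanded (`prob_PDu`), the `a₃`-masses having collapsed (`prob_PD_zero`).
Hence **`HCov_pendant_of_beta1`**: `0 ≤ β₁(p₀; o, a₁, a₂, u, b)` and (HCOV) at the base `(p₀, a₃ := u)`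
give (HCOV) at the pendant instance — row 2′BETA1's bracket is exactly what the pendant class needs.
-/

namespace Summit.Ventures.PercRepro2

open CovForm UnionCluster

namespace PMPendant

section Split

variable {V : Type*} {E : Type*} [Fintype E] [DecidableEq E] {R : Type*} [Field R]
  (p : E → R) (ends : E → Sym2 V) (a₁ a₂ : V)

omit [Fintype E] [DecidableEq E] in
/-- `Q = {a₂ ↮ a₁}` as `avoidAll` is the complement of the connection event. -/
lemma avoidAll_eq_compl : avoidAll ends a₂ {a₁} = (connEvent ends a₁ a₂)ᶜ := by
  ext ω
  simp only [mem_avoidAll, Finset.mem_singleton, forall_eq, Set.mem_compl_iff, mem_connEvent]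
  exact ⟨fun h hc => h (conn_symm hc), fun h hc => h (conn_symm hc)⟩

omit [Fintype E] [DecidableEq E] in
/-- On `Q`, `{x ∈ C₁}` and `{x ∈ C₂}` are disjoint. -/
lemma disjoint_LH_Q (x : V) (Y : Set (Config E)) :
    Disjoint (Y ∩ connEvent ends a₁ x ∩ (connEvent ends a₁ a₂)ᶜ)
      (Y ∩ connEvent ends a₂ x ∩ (connEvent ends a₁ a₂)ᶜ) := by
  rw [Set.disjoint_left]
  rintro ω ⟨⟨_, h1⟩, hQ⟩ ⟨⟨_, h2⟩, _⟩
  exact hQ (conn_trans h1 (conn_symm h2))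

/-- The union `{x ∈ C₁ ∪ C₂}` splits on `Q`. -/
lemma prob_union_Q (x : V) (Y : Set (Config E)) :
    prob p (Y ∩ (connEvent ends a₁ x ∪ connEvent ends a₂ x) ∩ (connEvent ends a₁ a₂)ᶜ) =
      prob p (Y ∩ connEvent ends a₁ x ∩ (connEvent ends a₁ a₂)ᶜ) +
        prob p (Y ∩ connEvent ends a₂ x ∩ (connEvent ends a₁ a₂)ᶜ) := by
  rw [← prob_union_of_disjoint p (disjoint_LH_Q ends a₁ a₂ x Y)]
  congr 1
  ext ω
  simp only [Set.mem_inter_iff, Set.mem_union]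
  tauto

/-- The union `{x ∈ C₁ ∪ C₂}` splits on `Q` (no other factor). -/
lemma prob_union_Q' (x : V) :
    prob p ((connEvent ends a₁ x ∪ connEvent ends a₂ x) ∩ (connEvent ends a₁ a₂)ᶜ) =
      prob p (connEvent ends a₁ x ∩ (connEvent ends a₁ a₂)ᶜ) +
        prob p (connEvent ends a₂ x ∩ (connEvent ends a₁ a₂)ᶜ) := by
  have h := prob_union_Q p ends a₁ a₂ x Set.univ
  simpa only [Set.univ_inter] using h

/-- `PD_u ∩ Y = Q ∩ Y` minus the two root clusters at `u`. -/
lemma prob_PDu (u : V) (Y : Set (Config E)) :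
    prob p (PDEvent ends a₁ a₂ u ∩ Y) =
      prob p (Y ∩ (connEvent ends a₁ a₂)ᶜ) -
        prob p (Y ∩ connEvent ends a₁ u ∩ (connEvent ends a₁ a₂)ᶜ) -
        prob p (Y ∩ connEvent ends a₂ u ∩ (connEvent ends a₁ a₂)ᶜ) := by
  have e : PDEvent ends a₁ a₂ u ∩ Y =
      (Y ∩ (connEvent ends a₁ a₂)ᶜ) ∩ (Y ∩ (connEvent ends a₁ u ∪ connEvent ends a₂ u) ∩
        (connEvent ends a₁ a₂)ᶜ)ᶜ := by
    ext ω
    simp only [PDEvent, Dtilde, Set.mem_inter_iff, Set.mem_compl_iff, mem_inU, mem_connEvent,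
      Set.mem_union, not_or]
    constructor
    · rintro ⟨⟨hQ, h1, h2⟩, hY⟩
      exact ⟨⟨hY, hQ⟩, fun h => h.1.2.elim (fun hc => h1 (conn_symm hc)) (fun hc => h2 (conn_symm hc))⟩
    · rintro ⟨⟨hY, hQ⟩, h⟩
      refine ⟨⟨hQ, fun hc => h ⟨⟨hY, Or.inl (conn_symm hc)⟩, hQ⟩,
        fun hc => h ⟨⟨hY, Or.inr (conn_symm hc)⟩, hQ⟩⟩, hY⟩
  have h := prob_inter_add_prob_inter_compl p (Y ∩ (connEvent ends a₁ a₂)ᶜ)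
    (Y ∩ (connEvent ends a₁ u ∪ connEvent ends a₂ u) ∩ (connEvent ends a₁ a₂)ᶜ)
  have e2 : Y ∩ (connEvent ends a₁ a₂)ᶜ ∩ (Y ∩ (connEvent ends a₁ u ∪ connEvent ends a₂ u) ∩
      (connEvent ends a₁ a₂)ᶜ) = Y ∩ (connEvent ends a₁ u ∪ connEvent ends a₂ u) ∩
      (connEvent ends a₁ a₂)ᶜ := by
    ext ω; simp only [Set.mem_inter_iff, Set.mem_union]; tauto
  rw [e]
  rw [e2, prob_union_Q p ends a₁ a₂ u Y] at h
  linear_combination h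

/-- `PD_u = Q` minus the two root clusters at `u`. -/
lemma prob_PDu' (u : V) :
    prob p (PDEvent ends a₁ a₂ u) =
      prob p (connEvent ends a₁ a₂)ᶜ -
        prob p (connEvent ends a₁ u ∩ (connEvent ends a₁ a₂)ᶜ) -
        prob p (connEvent ends a₂ u ∩ (connEvent ends a₁ a₂)ᶜ) := by
  have h := prob_PDu p ends a₁ a₂ u Set.univ
  simpa only [Set.inter_univ, Set.univ_inter] using h

end Split

section Beta

variable {V : Type*} {E : Type*} [Fintype E] [DecidableEq E] [DecidableEq V]
  {R : Type*} [Field R] [LinearOrder R] [IsStrictOrderedRing R]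
  {ends : E → Sym2 V} {a₃ u : V} {f : E}
  (hf : ends f = s(a₃, u)) (hleaf : ∀ e, a₃ ∈ ends e → e = f) (h3u : a₃ ≠ u)
  (p : E → R) (o a₁ a₂ b : V) (h31 : a₁ ≠ a₃) (h32 : a₂ ≠ a₃)
include hf hleaf h3u h31 h32

set_option maxHeartbeats 4000000 in
omit [DecidableEq V] in
/-- **The middle coefficient is twice the typed bracket `β₁`** (`RootPairSepTyped.lean`'s expression
with the marks `(a₁, a₂, o, u, b)`, at `p₀ = p[f ↦ 0]`): `twoBeta1 = 2 · (L + H + A)`. -/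
theorem twoBeta1_eq :
    twoBeta1 (Function.update p f 0) ends o a₁ a₂ a₃ u b =
      2 * (prob (Function.update p f 0) (connEvent ends a₁ a₂)ᶜ *
          (prob (Function.update p f 0) (connEvent ends a₁ a₂)ᶜ * prob (Function.update p f 0) (connEvent ends a₁ b ∩ connEvent ends a₂ u ∩ (connEvent ends a₁ o ∪ connEvent ends a₂ o) ∩ (connEvent ends a₁ a₂)ᶜ) -
            prob (Function.update p f 0) (connEvent ends a₁ b ∩ (connEvent ends a₁ a₂)ᶜ) * prob (Function.update p f 0) (connEvent ends a₂ u ∩ (connEvent ends a₁ o ∪ connEvent ends a₂ o) ∩ (connEvent ends a₁ a₂)ᶜ)) -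
        prob (Function.update p f 0) ((connEvent ends a₁ o ∪ connEvent ends a₂ o) ∩ (connEvent ends a₁ a₂)ᶜ) *
          (prob (Function.update p f 0) (connEvent ends a₁ a₂)ᶜ * prob (Function.update p f 0) (connEvent ends a₁ b ∩ connEvent ends a₂ u ∩ (connEvent ends a₁ a₂)ᶜ) -
            prob (Function.update p f 0) (connEvent ends a₁ b ∩ (connEvent ends a₁ a₂)ᶜ) * prob (Function.update p f 0) (connEvent ends a₂ u ∩ (connEvent ends a₁ a₂)ᶜ)) -
        prob (Function.update p f 0) (connEvent ends a₁ a₂)ᶜ *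
          (prob (Function.update p f 0) (connEvent ends a₁ a₂)ᶜ * prob (Function.update p f 0) (connEvent ends a₁ b ∩ connEvent ends a₂ o ∩ (connEvent ends a₁ a₂)ᶜ) -
            prob (Function.update p f 0) (connEvent ends a₁ b ∩ (connEvent ends a₁ a₂)ᶜ) * prob (Function.update p f 0) (connEvent ends a₂ o ∩ (connEvent ends a₁ a₂)ᶜ)) +
        prob (Function.update p f 0) (connEvent ends a₁ a₂)ᶜ *
          (prob (Function.update p f 0) (connEvent ends a₁ a₂)ᶜ * prob (Function.update p f 0) (connEvent ends a₂ b ∩ connEvent ends a₁ u ∩ (connEvent ends a₁ o ∪ connEvent ends a₂ o) ∩ (connEvent ends a₁ a₂)ᶜ) -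
            prob (Function.update p f 0) (connEvent ends a₂ b ∩ (connEvent ends a₁ a₂)ᶜ) * prob (Function.update p f 0) (connEvent ends a₁ u ∩ (connEvent ends a₁ o ∪ connEvent ends a₂ o) ∩ (connEvent ends a₁ a₂)ᶜ)) -
        prob (Function.update p f 0) ((connEvent ends a₁ o ∪ connEvent ends a₂ o) ∩ (connEvent ends a₁ a₂)ᶜ) *
          (prob (Function.update p f 0) (connEvent ends a₁ a₂)ᶜ * prob (Function.update p f 0) (connEvent ends a₂ b ∩ connEvent ends a₁ u ∩ (connEvent ends a₁ a₂)ᶜ) -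
            prob (Function.update p f 0) (connEvent ends a₂ b ∩ (connEvent ends a₁ a₂)ᶜ) * prob (Function.update p f 0) (connEvent ends a₁ u ∩ (connEvent ends a₁ a₂)ᶜ)) -
        prob (Function.update p f 0) (connEvent ends a₁ a₂)ᶜ *
          (prob (Function.update p f 0) (connEvent ends a₁ a₂)ᶜ * prob (Function.update p f 0) (connEvent ends a₂ b ∩ connEvent ends a₁ o ∩ (connEvent ends a₁ a₂)ᶜ) -
            prob (Function.update p f 0) (connEvent ends a₂ b ∩ (connEvent ends a₁ a₂)ᶜ) * prob (Function.update p f 0) (connEvent ends a₁ o ∩ (connEvent ends a₁ a₂)ᶜ)) +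
        (prob (Function.update p f 0) ((connEvent ends a₁ u ∪ connEvent ends a₂ u) ∩ (connEvent ends a₁ a₂)ᶜ) - prob (Function.update p f 0) (connEvent ends a₁ a₂)ᶜ) *
          (prob (Function.update p f 0) (connEvent ends a₁ a₂)ᶜ * prob (Function.update p f 0) (connEvent ends a₁ b ∩ connEvent ends a₂ o ∩ (connEvent ends a₁ a₂)ᶜ) - prob (Function.update p f 0) (connEvent ends a₁ b ∩ (connEvent ends a₁ a₂)ᶜ) * prob (Function.update p f 0) (connEvent ends a₂ o ∩ (connEvent ends a₁ a₂)ᶜ) +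
            prob (Function.update p f 0) (connEvent ends a₁ a₂)ᶜ * prob (Function.update p f 0) (connEvent ends a₂ b ∩ connEvent ends a₁ o ∩ (connEvent ends a₁ a₂)ᶜ) - prob (Function.update p f 0) (connEvent ends a₂ b ∩ (connEvent ends a₁ a₂)ᶜ) * prob (Function.update p f 0) (connEvent ends a₁ o ∩ (connEvent ends a₁ a₂)ᶜ))) := by
  unfold twoBeta1 EQbo EQb3 EQb3o EQo EQ3 EQ3o PDb PDbo Do
  rw [gap_eq_Q]
  -- the isolated `a₃`: its `PD`-masses are `Q`-masses
  rw [prob_PD_zero' hf hleaf h3u p a₁ a₂ h31 h32]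
  simp only [prob_PD_zero hf hleaf h3u p a₁ a₂ h31 h32]
  -- the glued `u`: `PD_u` expanded, the unions split
  simp only [prob_PDu, prob_PDu', prob_union_Q, prob_union_Q']
  -- one vocabulary: `Q = (connEvent a₁ a₂)ᶜ`, `T`-events unfolded, connection events oriented
  simp only [avoidAll_eq_compl, TEvent, connEvent_comm ends a₂ a₁]
  simp only [Set.inter_comm, Set.inter_left_comm]
  ring

/-- **(HCOV) at a pendant `a₃` from row 2′BETA1's bracket**: `0 ≤ β₁(p₀; a₁, a₂, o, u, b)`
(`β₁ = (HALF-PM⁺)_L + (HALF-PM⁺)_H + A`, the typed bracket of `RootPairSepTyped.lean`) and (HCOV) at the base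
instance `(p₀, a₃ := u)` give (HCOV) at the pendant instance `(p, a₃)`. -/
theorem HCov_pendant_of_beta1 [Fintype V] (hp : IsProbVec p) (h3o : o ≠ a₃) (h3b : b ≠ a₃)
    (hβ : 0 ≤ prob (Function.update p f 0) (connEvent ends a₁ a₂)ᶜ *
          (prob (Function.update p f 0) (connEvent ends a₁ a₂)ᶜ * prob (Function.update p f 0) (connEvent ends a₁ b ∩ connEvent ends a₂ u ∩ (connEvent ends a₁ o ∪ connEvent ends a₂ o) ∩ (connEvent ends a₁ a₂)ᶜ) -
            prob (Function.update p f 0) (connEvent ends a₁ b ∩ (connEvent ends a₁ a₂)ᶜ) * prob (Function.update p f 0) (connEvent ends a₂ u ∩ (connEvent ends a₁ o ∪ connEvent ends a₂ o) ∩ (connEvent ends a₁ a₂)ᶜ)) -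
        prob (Function.update p f 0) ((connEvent ends a₁ o ∪ connEvent ends a₂ o) ∩ (connEvent ends a₁ a₂)ᶜ) *
          (prob (Function.update p f 0) (connEvent ends a₁ a₂)ᶜ * prob (Function.update p f 0) (connEvent ends a₁ b ∩ connEvent ends a₂ u ∩ (connEvent ends a₁ a₂)ᶜ) -
            prob (Function.update p f 0) (connEvent ends a₁ b ∩ (connEvent ends a₁ a₂)ᶜ) * prob (Function.update p f 0) (connEvent ends a₂ u ∩ (connEvent ends a₁ a₂)ᶜ)) -
        prob (Function.update p f 0) (connEvent ends a₁ a₂)ᶜ *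
          (prob (Function.update p f 0) (connEvent ends a₁ a₂)ᶜ * prob (Function.update p f 0) (connEvent ends a₁ b ∩ connEvent ends a₂ o ∩ (connEvent ends a₁ a₂)ᶜ) -
            prob (Function.update p f 0) (connEvent ends a₁ b ∩ (connEvent ends a₁ a₂)ᶜ) * prob (Function.update p f 0) (connEvent ends a₂ o ∩ (connEvent ends a₁ a₂)ᶜ)) +
        prob (Function.update p f 0) (connEvent ends a₁ a₂)ᶜ *
          (prob (Function.update p f 0) (connEvent ends a₁ a₂)ᶜ * prob (Function.update p f 0) (connEvent ends a₂ b ∩ connEvent ends a₁ u ∩ (connEvent ends a₁ o ∪ connEvent ends a₂ o) ∩ (connEvent ends a₁ a₂)ᶜ) -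
            prob (Function.update p f 0) (connEvent ends a₂ b ∩ (connEvent ends a₁ a₂)ᶜ) * prob (Function.update p f 0) (connEvent ends a₁ u ∩ (connEvent ends a₁ o ∪ connEvent ends a₂ o) ∩ (connEvent ends a₁ a₂)ᶜ)) -
        prob (Function.update p f 0) ((connEvent ends a₁ o ∪ connEvent ends a₂ o) ∩ (connEvent ends a₁ a₂)ᶜ) *
          (prob (Function.update p f 0) (connEvent ends a₁ a₂)ᶜ * prob (Function.update p f 0) (connEvent ends a₂ b ∩ connEvent ends a₁ u ∩ (connEvent ends a₁ a₂)ᶜ) -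
            prob (Function.update p f 0) (connEvent ends a₂ b ∩ (connEvent ends a₁ a₂)ᶜ) * prob (Function.update p f 0) (connEvent ends a₁ u ∩ (connEvent ends a₁ a₂)ᶜ)) -
        prob (Function.update p f 0) (connEvent ends a₁ a₂)ᶜ *
          (prob (Function.update p f 0) (connEvent ends a₁ a₂)ᶜ * prob (Function.update p f 0) (connEvent ends a₂ b ∩ connEvent ends a₁ o ∩ (connEvent ends a₁ a₂)ᶜ) -
            prob (Function.update p f 0) (connEvent ends a₂ b ∩ (connEvent ends a₁ a₂)ᶜ) * prob (Function.update p f 0) (connEvent ends a₁ o ∩ (connEvent ends a₁ a₂)ᶜ)) +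
        (prob (Function.update p f 0) ((connEvent ends a₁ u ∪ connEvent ends a₂ u) ∩ (connEvent ends a₁ a₂)ᶜ) - prob (Function.update p f 0) (connEvent ends a₁ a₂)ᶜ) *
          (prob (Function.update p f 0) (connEvent ends a₁ a₂)ᶜ * prob (Function.update p f 0) (connEvent ends a₁ b ∩ connEvent ends a₂ o ∩ (connEvent ends a₁ a₂)ᶜ) - prob (Function.update p f 0) (connEvent ends a₁ b ∩ (connEvent ends a₁ a₂)ᶜ) * prob (Function.update p f 0) (connEvent ends a₂ o ∩ (connEvent ends a₁ a₂)ᶜ) +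
            prob (Function.update p f 0) (connEvent ends a₁ a₂)ᶜ * prob (Function.update p f 0) (connEvent ends a₂ b ∩ connEvent ends a₁ o ∩ (connEvent ends a₁ a₂)ᶜ) - prob (Function.update p f 0) (connEvent ends a₂ b ∩ (connEvent ends a₁ a₂)ᶜ) * prob (Function.update p f 0) (connEvent ends a₁ o ∩ (connEvent ends a₁ a₂)ᶜ)))
    (hbase : HCov (Function.update p f 0) ends o a₁ a₂ u b) : HCov p ends o a₁ a₂ a₃ b :=
  HCov_pendant_of_PM hf hleaf h3u p o a₁ a₂ b h3o h31 h32 h3b hp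
    (by rw [twoBeta1_eq hf hleaf h3u p o a₁ a₂ b h31 h32]; exact mul_nonneg (by norm_num) hβ) hbase

end Beta

end PMPendant

end Summit.Ventures.PercRepro2
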